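import Literature.AlgebraicGeometry.Resolution.ProjectiveModelsDomination
import HarnessLib

/-!
# `WildQuotients.SummitReduction` (stmt-ResolutionOfSingularities-16324), line `FramePerfect`, stub 1a:
# the closure of the graph of `X ⇢ Y` and its `G`-action

Route `ResolutionOfSingularities/WildQuotients`, crux `SummitReduction`; helper file of stub
`stub_pair_equivariantFibration` (de Jong 1997, Lemma 5.2: "This defines a `G`-equivariant rational
map `X ⇢ P^{d-1}`. Therefore there is a projective modification `X' → X` on which `G` acts such
that there is a `G`-equivariant morphism `X' → P^{d-1}`"). In the tree's language of projective
models: for projective models `X` of `K/k` and `Y` of `L/k` (`L ⊆ K`) with `k`-linear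
`G`-actions compatible with the generic points — `gen_X ≫ ρ g = Spec(e_K g) ≫ gen_X`,
`gen_Y ≫ ρY g = Spec(e_L g) ≫ gen_Y`, `e_K g|_L = e_L g` — the CLOSURE MODEL `X'` of the
`K`-point `(gen_X, Spec K → Spec L → Y)` of `X ×ₖ Y` (`ProjModel.ofClosure`: the closure of the
graph of the rational map `X ⇢ Y`) dominates `X` (a modification: `ProjModel.Hom.isBirational`),
maps to `Y` compatibly with the generic points, and carries a `G`-action making both maps
equivariant: `G` acts on `X ×ₖ Y` diagonally, the `K`-point is equivariant, hence its closure is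
`G`-stable and the action restricts (`IsClosedImmersion.liftOfRange`, `X'` being reduced).

* `exists_closureModel_equivariant` — the statement just described.
-/

set_option linter.dupNamespace false

noncomputable section

open CategoryTheory CategoryTheory.Limits AlgebraicGeometry TopologicalSpace IsLocalRing
  MonoidalCategory CartesianMonoidalCategory

namespace Summit.ResolutionOfSingularities.ResolutionOfSingularities.Theorems

open Literature.AlgebraicGeometry.Resolution Literature.AlgebraicGeometry.Motives

universe u

/-- **The closure of the graph of an equivariant rational map, with its `G`-action** (de Jong
1997, Lemma 5.2: "there is a projective modification `X' → X` on which `G` acts such that there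
is a `G`-equivariant morphism `X' → P^{d-1}`"; here with an arbitrary projective model `Y` of a
subfield `L ⊆ K = K(X)` in place of `P^{d-1}`). Given projective models `X` of `K/k` and `Y` of
`L/k` with `k`-linear actions `ρ`, `ρY` of a group `G` such that
`gen_X ≫ ρ g = Spec(e_K g) ≫ gen_X`, `gen_Y ≫ ρY g = Spec(e_L g) ≫ gen_Y` for ring endomorphisms
`e_K g` of `K` (over `k`) restricting to `e_L g` on `L`, the closure model `X'` of the `K`-point
`(gen_X, Spec K → Spec L → Y)` in `X ×ₖ Y` (`ProjModel.ofClosure`) has: a morphism of models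
`φ : X' → X` (proper birational), a `k`-morphism `fc : X' → Y` with
`gen_{X'} ≫ fc = Spec(L ⊆ K) ≫ gen_Y`, and an action `ρX'` with `φ`, `fc` equivariant — `G` acts
diagonally on `X ×ₖ Y`, the `K`-point is equivariant, so the reduced closed subscheme `X'` is
stable. [cite: DeJong1997, Lemma 5.2 (proof), p. 613] -/
theorem exists_closureModel_equivariant {k K Lt : Type u} [Field k] [Field K] [Field Lt]
    [Algebra k K] [Algebra k Lt] [Algebra Lt K] [IsScalarTower k Lt K]
    (MX : ProjModel k K) (MY : ProjModel k Lt) {G : Type*} [Group G]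
    (ρ : G →* Aut MX.X) (hρ : ∀ g : G, (ρ g).hom ≫ MX.π = MX.π)
    (eK : G → (K →+* K)) (heK : ∀ (g : G) (c : k), eK g (algebraMap k K c) = algebraMap k K c)
    (hX : ∀ g : G, MX.gen ≫ (ρ g).hom = Spec.map (CommRingCat.ofHom (eK g)) ≫ MX.gen)
    (ρY : G →* Aut MY.X) (hρY : ∀ g : G, (ρY g).hom ≫ MY.π = MY.π) (eL : G → (Lt →+* Lt))
    (hY : ∀ g : G, MY.gen ≫ (ρY g).hom = Spec.map (CommRingCat.ofHom (eL g)) ≫ MY.gen)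
    (hcompat : ∀ g : G, (algebraMap Lt K).comp (eL g) = (eK g).comp (algebraMap Lt K)) :
    ∃ (X' : ProjModel k K) (φ : X'.Hom MX) (fc : X'.X ⟶ MY.X) (ρX' : G →* Aut X'.X),
      (∀ g : G, (ρX' g).hom ≫ φ.f = φ.f ≫ (ρ g).hom) ∧
      (∀ g : G, (ρX' g).hom ≫ fc = fc ≫ (ρY g).hom) ∧
      fc ≫ MY.π = X'.π ∧
      X'.gen ≫ fc = Spec.map (CommRingCat.ofHom (algebraMap Lt K)) ≫ MY.gen := by
  classical
  -- the ambient `X ×ₖ Y` and the `K`-point `(gen_X, Spec K → Spec L → Y)`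
  let Q : SchemeOver k := MX.toOver ⊗ MY.toOver
  have hQ : IsProjectiveOver Q := MX.isProjectiveOver.tensor MY.isProjectiveOver
  have hyK : (Spec.map (CommRingCat.ofHom (algebraMap Lt K)) ≫ MY.gen) ≫ MY.toOver.hom =
      (ProjModel.specOverK k K).hom := by
    change (Spec.map _ ≫ MY.gen) ≫ MY.π = Spec.map (CommRingCat.ofHom (algebraMap k K))
    rw [Category.assoc, MY.gen_π, ← Spec.map_comp, ← CommRingCat.ofHom_comp,
      ← IsScalarTower.algebraMap_eq]
  let yK : ProjModel.specOverK k K ⟶ MY.toOver :=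
    Over.homMk (Spec.map (CommRingCat.ofHom (algebraMap Lt K)) ≫ MY.gen) hyK
  let rlO : ProjModel.specOverK k K ⟶ Q := lift (ProjModel.genOver MX) yK
  let rl : Spec (CommRingCat.of K) ⟶ Q.left := rlO.left
  let s : Q.left ⟶ MX.X := (fst MX.toOver MY.toOver).left
  let t : Q.left ⟶ MY.X := (snd MX.toOver MY.toOver).left
  have hs : s ≫ MX.π = Q.hom := Over.w (fst MX.toOver MY.toOver)
  have ht : t ≫ MY.π = Q.hom := Over.w (snd MX.toOver MY.toOver)
  have hr : rl ≫ s = MX.gen := by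
    change (rlO ≫ fst MX.toOver MY.toOver).left = (ProjModel.genOver MX).left
    rw [lift_fst]
  have hrt : rl ≫ t = Spec.map (CommRingCat.ofHom (algebraMap Lt K)) ≫ MY.gen := by
    change (rlO ≫ snd MX.toOver MY.toOver).left = yK.left
    rw [lift_snd]
  let X' : ProjModel k K := ProjModel.ofClosure MX hQ rl s hs hr
  let φ : X'.Hom MX := ProjModel.ofClosure.homOf MX hQ rl s hs hr MX s hs hr
  let ι' : X'.X ⟶ Q.left := rl.imageι
  let fc : X'.X ⟶ MY.X := ι' ≫ t
  -- the diagonal action on `X ×ₖ Y`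
  let ρO : G → (MX.toOver ≅ MX.toOver) := fun g => Over.isoMk (ρ g) (hρ g)
  let ρYO : G → (MY.toOver ≅ MY.toOver) := fun g => Over.isoMk (ρY g) (hρY g)
  let σ : G → (Q ≅ Q) := fun g => ρO g ⊗ᵢ ρYO g
  have hρO_mul : ∀ g h, (ρO (g * h)).hom = (ρO h).hom ≫ (ρO g).hom := fun g h =>
    Over.OverMorphism.ext (by
      change (ρ (g * h)).hom = (ρ h).hom ≫ (ρ g).hom; rw [map_mul]; rfl)
  have hρYO_mul : ∀ g h, (ρYO (g * h)).hom = (ρYO h).hom ≫ (ρYO g).hom := fun g h =>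
    Over.OverMorphism.ext (by
      change (ρY (g * h)).hom = (ρY h).hom ≫ (ρY g).hom; rw [map_mul]; rfl)
  have hσ_mul : ∀ g h, (σ (g * h)).hom.left = (σ h).hom.left ≫ (σ g).hom.left := by
    intro g h
    rw [← Over.comp_left]
    congr 1
    change (ρO (g * h)).hom ⊗ₘ (ρYO (g * h)).hom =
      ((ρO h).hom ⊗ₘ (ρYO h).hom) ≫ ((ρO g).hom ⊗ₘ (ρYO g).hom)
    rw [tensorHom_comp_tensorHom, hρO_mul, hρYO_mul]
  have hσ_one : (σ 1).hom.left = 𝟙 _ := by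
    have h1 : (ρO 1).hom = 𝟙 _ :=
      Over.OverMorphism.ext (by change (ρ 1).hom = 𝟙 _; rw [map_one]; rfl)
    have h2 : (ρYO 1).hom = 𝟙 _ :=
      Over.OverMorphism.ext (by change (ρY 1).hom = 𝟙 _; rw [map_one]; rfl)
    change ((ρO 1).hom ⊗ₘ (ρYO 1).hom).left = 𝟙 _
    rw [h1, h2, id_tensorHom_id]
    rfl
  have hσs : ∀ g, (σ g).hom.left ≫ s = s ≫ (ρ g).hom := by
    intro g
    change ((σ g).hom ≫ fst MX.toOver MY.toOver).left =
      (fst MX.toOver MY.toOver ≫ (ρO g).hom).left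
    rw [tensorIso_hom, tensorHom_fst]
  have hσt : ∀ g, (σ g).hom.left ≫ t = t ≫ (ρY g).hom := by
    intro g
    change ((σ g).hom ≫ snd MX.toOver MY.toOver).left =
      (snd MX.toOver MY.toOver ≫ (ρYO g).hom).left
    rw [tensorIso_hom, tensorHom_snd]
  -- the `K`-point is equivariant
  have hsK : ∀ g, Spec.map (CommRingCat.ofHom (eK g)) ≫ (ProjModel.specOverK k K).hom =
      (ProjModel.specOverK k K).hom := by
    intro g
    change Spec.map _ ≫ Spec.map (CommRingCat.ofHom (algebraMap k K)) = _
    rw [← Spec.map_comp, ← CommRingCat.ofHom_comp]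
    congr 2
    ext c
    exact heK g c
  let sK : G → (ProjModel.specOverK k K ⟶ ProjModel.specOverK k K) := fun g =>
    Over.homMk (Spec.map (CommRingCat.ofHom (eK g))) (hsK g)
  have hrl : ∀ g, rl ≫ (σ g).hom.left = Spec.map (CommRingCat.ofHom (eK g)) ≫ rl := by
    intro g
    change (rlO ≫ (σ g).hom).left = (sK g ≫ rlO).left
    congr 1
    apply CartesianMonoidalCategory.hom_ext
    · rw [Category.assoc, tensorIso_hom, tensorHom_fst, lift_fst_assoc, Category.assoc,
        lift_fst]
      apply Over.OverMorphism.ext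
      change MX.gen ≫ (ρ g).hom = Spec.map (CommRingCat.ofHom (eK g)) ≫ MX.gen
      exact hX g
    · rw [Category.assoc, tensorIso_hom, tensorHom_snd, lift_snd_assoc, Category.assoc,
        lift_snd]
      apply Over.OverMorphism.ext
      change (Spec.map (CommRingCat.ofHom (algebraMap Lt K)) ≫ MY.gen) ≫ (ρY g).hom =
        Spec.map (CommRingCat.ofHom (eK g)) ≫ Spec.map (CommRingCat.ofHom (algebraMap Lt K)) ≫
          MY.gen
      rw [Category.assoc, hY, ← Spec.map_comp_assoc, ← Spec.map_comp_assoc,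
        ← CommRingCat.ofHom_comp, ← CommRingCat.ofHom_comp, hcompat]
  -- the closure is stable
  have hrange : Set.range ι' = closure (Set.range rl) := by
    change Set.range rl.imageι = _
    rw [Scheme.IdealSheafData.range_subschemeι, Scheme.Hom.support_ker]
  have hstab : ∀ g, Set.range (ι' ≫ (σ g).hom.left) ⊆ Set.range ι' := by
    intro g
    rw [hrange, Scheme.Hom.comp_base, TopCat.coe_comp, Set.range_comp, hrange]
    refine (image_closure_subset_closure_image (σ g).hom.left.continuous).trans ?_
    apply closure_mono
    rw [← Set.range_comp, ← TopCat.coe_comp, ← Scheme.Hom.comp_base, hrl g,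
      Scheme.Hom.comp_base, TopCat.coe_comp]
    exact Set.range_comp_subset_range _ _
  haveI : IsClosedImmersion ι' := inferInstanceAs (IsClosedImmersion rl.imageι)
  let τ : G → (X'.X ⟶ X'.X) := fun g =>
    IsClosedImmersion.liftOfRange ι' (ι' ≫ (σ g).hom.left) (hstab g)
  have hτ : ∀ g, τ g ≫ ι' = ι' ≫ (σ g).hom.left := fun g =>
    IsClosedImmersion.liftOfRange_fac _ _ _
  have hτ_mul : ∀ g h, τ (g * h) = τ h ≫ τ g := by
    intro g h
    rw [← cancel_mono ι', Category.assoc, hτ (g * h), hσ_mul, hτ g, reassoc_of% (hτ h)]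
  have hτ_one : τ 1 = 𝟙 _ := by
    rw [← cancel_mono ι', hτ, hσ_one, Category.id_comp, Category.comp_id]
  let ρX' : G →* Aut X'.X :=
    { toFun := fun g =>
        { hom := τ g
          inv := τ g⁻¹
          hom_inv_id := by rw [← hτ_mul, inv_mul_cancel, hτ_one]
          inv_hom_id := by rw [← hτ_mul, mul_inv_cancel, hτ_one] }
      map_one' := by ext; exact hτ_one
      map_mul' := fun g h => by ext; exact hτ_mul g h }
  refine ⟨X', φ, fc, ρX', fun g => ?_, fun g => ?_, ?_, ?_⟩
  · change τ g ≫ ι' ≫ s = (ι' ≫ s) ≫ (ρ g).hom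
    rw [← Category.assoc, hτ, Category.assoc, hσs, Category.assoc]
  · change τ g ≫ ι' ≫ t = (ι' ≫ t) ≫ (ρY g).hom
    rw [← Category.assoc, hτ, Category.assoc, hσt, Category.assoc]
  · change (ι' ≫ t) ≫ MY.π = rl.imageι ≫ Q.hom
    rw [Category.assoc, ht]
    rfl
  · change rl.toImage ≫ ι' ≫ t = _
    rw [← Category.assoc]
    change (rl.toImage ≫ rl.imageι) ≫ t = _
    rw [Scheme.Hom.toImage_imageι, hrt]

end Summit.ResolutionOfSingularities.ResolutionOfSingularities.Theorems

end
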